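import Mathlib
import Literature.Analysis.FluidPDE.ClassicalSolution
import Literature.Analysis.FluidPDE.LerayHopf
import Literature.Analysis.FluidPDE.NSWave0
import Summits.NavierStokesRegularity.NavierStokesRegularity.Theses.L3TimeExponentPincer
import Summits.NavierStokesRegularity.NavierStokesRegularity.Theorems.L3TimeExponentPincerFullMorreyMostTimes
import Summits.NavierStokesRegularity.NavierStokesRegularity.Theorems.L3TimeExponentPincerL3BiteMorreyRate
import Summits.NavierStokesRegularity.NavierStokesRegularity.Theorems.L3TimeExponentPincerJawExponentCalculus
import HarnessLib

/-!
# Crux `L3CascadeJaw` (stmt-NavierStokesRegularity-19499) equals its weak-`L^q` (Lorentz) form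

Support file for the PARENT crux `L3CascadeJaw` of route `L3TimeExponentPincer` (cell
ns-regularity-ideate, seat ns-pincer-19499-p1).  The clause of the crux asks STRONG time-integrability
`∫_{T₂}^T ‖u(t)‖₃^q dt < ∞`; the planners' "temporal floor" / Lorentz door `W(q)` (nsreg-p2 ROUND-7,
`TemporalFloor.lean`, evidence on the item) asks only the WEAK-`L^q` (Chebyshev-tail) bound
`sup_{s>0} s^q |{t ∈ (T₂,T) : ‖u(t)‖₃ > s}| < ∞`.  Because the crux quantifies over the OPEN range
`4 < q < 5`, the two are equivalent BY NAME:

* `weakJawClause_of_lintegral_lt_top` — strong at `q` ⇒ weak at `q` on the same window (Markov's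
  inequality for `‖u(·)‖₃^q`, a.e.-measurable in time for a frame solution);
* `lintegral_lt_top_of_weakJawClause` — weak at `q'` ⇒ strong at every `1 ≤ q < q'` on the same window
  (layer cake `∫ f^q = q ∫₀^∞ s^{q-1}|{f > s}| ds`, the tail bounded by `|window|` for `s ≤ 1` and by
  `C s^{-q'}` for `s > 1`, `∫₁^∞ s^{q-1-q'} ds < ∞`);
* **`l3CascadeJaw_iff_weak`** — `L3CascadeJaw ↔` "for every `q ∈ (4,5)` every frame solution has a final
  window on which `t ↦ ‖u(t)‖₃` is in weak-`L^q`".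

So a proof of the crux may aim at tail/measure estimates of the `L³`-fast sets
`{‖u(t)‖₃ > s}` (density statements of the kind `quarterFast_density_zero`, p453065, one exponent lower)
rather than at the integral itself; and a refutation may exhibit a single blow-up with
`limsup_s s^q |{‖u‖₃ > s} ∩ (T₂,T)| = ∞` for some `q < 5`.

WHAT THIS IS NOT: not a claim about Navier–Stokes regularity or blow-up; a kernel-checked reformulation
of the crux AS TYPED, landed `--supports … --as helper`.
-/

noncomputable section

namespace Summit.NavierStokesRegularity.NavierStokesRegularity.Theorems.L3TimeExponentPincerJawWeakStrong

open MeasureTheory Set Function Filter Topology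
open scoped ENNReal NNReal
open Literature.Analysis.FluidPDE
open Summit.NavierStokesRegularity.NavierStokesRegularity.Theses.L3TimeExponentPincer (L3CascadeJaw)
open Summit.NavierStokesRegularity.NavierStokesRegularity.Theorems.L3TimeExponentPincerFullMorreyMostTimes
  (aemeasurable_l3cube_of_frame)
open Summit.NavierStokesRegularity.NavierStokesRegularity.Theorems.L3TimeExponentPincerL3BiteMorreyRate
  (eLpNorm_three_lt_top_of_frame)
open Summit.NavierStokesRegularity.NavierStokesRegularity.Theorems.L3TimeExponentPincerJawExponentCalculus
  (jawClause_anti)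

/-! ## Measurability of `t ↦ ‖u(t)‖₃` on windows -/

/-- `t ↦ ‖u(t)‖₃` is a.e.-measurable on every window `(T₂,T)`, `0 ≤ T₂`, for a classical solution on
`[0,T)` (from the cube, `aemeasurable_l3cube_of_frame`, through `y ↦ y^{1/3}`). [folklore] -/
theorem aemeasurable_l3_of_frame {ν T : ℝ}
    {u : ℝ → EuclideanSpace ℝ (Fin 3) → EuclideanSpace ℝ (Fin 3)} {p : ℝ → EuclideanSpace ℝ (Fin 3) → ℝ}
    (hcl : IsClassicalNSSolutionOn (Ico 0 T) ν 0 u p) {T₂ : ℝ} (hT₂ : 0 ≤ T₂) :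
    AEMeasurable (fun t => eLpNorm (u t) 3 volume) (volume.restrict (Ioo T₂ T)) := by
  have hle : volume.restrict (Ioo T₂ T) ≤ volume.restrict (Ioo 0 T) :=
    Measure.restrict_mono (Ioo_subset_Ioo_left hT₂) le_rfl
  have h := (ENNReal.continuous_rpow_const (y := (1 / 3 : ℝ))).measurable.comp_aemeasurable
    ((aemeasurable_l3cube_of_frame hcl).mono_measure hle)
  refine h.congr (Eventually.of_forall fun t => ?_)
  simp only [Function.comp]
  rw [← ENNReal.rpow_mul]
  norm_num

/-- `t ↦ ‖u(t)‖₃^q` is a.e.-measurable on every window `(T₂,T)`, `0 ≤ T₂`. [folklore] -/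
theorem aemeasurable_l3_rpow_of_frame {ν T : ℝ}
    {u : ℝ → EuclideanSpace ℝ (Fin 3) → EuclideanSpace ℝ (Fin 3)} {p : ℝ → EuclideanSpace ℝ (Fin 3) → ℝ}
    (hcl : IsClassicalNSSolutionOn (Ico 0 T) ν 0 u p) {T₂ : ℝ} (hT₂ : 0 ≤ T₂) (q : ℝ) :
    AEMeasurable (fun t => eLpNorm (u t) 3 volume ^ q) (volume.restrict (Ioo T₂ T)) :=
  (ENNReal.continuous_rpow_const (y := q)).measurable.comp_aemeasurable (aemeasurable_l3_of_frame hcl hT₂)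

/-! ## Strong ⇒ weak (Markov) -/

/-- **Strong integrability gives the weak-`L^q` tail bound on the same window** (Markov's inequality):
if `∫_{T₂}^T ‖u(t)‖₃^q dt < ∞` (`0 ≤ q`, `0 ≤ T₂`) then
`s^q · |{t ∈ (T₂,T) : ‖u(t)‖₃ > s}| ≤ ∫_{T₂}^T ‖u‖₃^q` for every `s > 0`. [folklore] -/
theorem weakJawClause_of_lintegral_lt_top {ν T : ℝ}
    {u : ℝ → EuclideanSpace ℝ (Fin 3) → EuclideanSpace ℝ (Fin 3)} {p : ℝ → EuclideanSpace ℝ (Fin 3) → ℝ}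
    (hcl : IsClassicalNSSolutionOn (Ico 0 T) ν 0 u p) {T₂ q : ℝ} (hT₂ : 0 ≤ T₂) (hq : 0 ≤ q)
    (hfin : (∫⁻ t in Ioo T₂ T, eLpNorm (u t) 3 volume ^ q) < ⊤) :
    ∃ C : ℝ≥0, ∀ s : ℝ, 0 < s →
      ENNReal.ofReal (s ^ q) * volume {t ∈ Ioo T₂ T | ENNReal.ofReal s < eLpNorm (u t) 3 volume} ≤ C := by
  refine ⟨(∫⁻ t in Ioo T₂ T, eLpNorm (u t) 3 volume ^ q).toNNReal, fun s hs => ?_⟩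
  rw [ENNReal.coe_toNNReal hfin.ne]
  set μ : Measure ℝ := volume.restrict (Ioo T₂ T) with hμ
  -- the fast set, measured by the restricted measure
  have hset : volume {t ∈ Ioo T₂ T | ENNReal.ofReal s < eLpNorm (u t) 3 volume} =
      μ {t | ENNReal.ofReal s < eLpNorm (u t) 3 volume} := by
    rw [hμ, Measure.restrict_apply' measurableSet_Ioo]
    congr 1
    ext t
    simp only [mem_setOf_eq, mem_inter_iff]
    tauto
  -- Markov for `‖u(·)‖₃^q` at level `(ofReal s)^q`
  have hmarkov := mul_meas_ge_le_lintegral₀ (aemeasurable_l3_rpow_of_frame hcl hT₂ q)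
    (ENNReal.ofReal s ^ q) (μ := μ)
  have hsub : {t | ENNReal.ofReal s < eLpNorm (u t) 3 volume} ⊆
      {t | ENNReal.ofReal s ^ q ≤ eLpNorm (u t) 3 volume ^ q} :=
    fun t ht => ENNReal.rpow_le_rpow (le_of_lt ht) hq
  rw [hset, ← ENNReal.ofReal_rpow_of_nonneg hs.le hq]
  exact (mul_le_mul_of_nonneg_left (measure_mono hsub) bot_le).trans hmarkov

/-! ## Weak ⇒ strong below the exponent (layer cake) -/

/-- `∫_{(1,∞)} s^r ds < ∞` (lower Lebesgue integral of `ofReal`) for `r < -1`. [folklore] -/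
theorem lintegral_Ioi_one_ofReal_rpow_lt_top {r : ℝ} (hr : r < -1) :
    (∫⁻ s in Ioi (1 : ℝ), ENNReal.ofReal (s ^ r)) < ⊤ := by
  have h := integrableOn_Ioi_rpow_of_lt hr one_pos
  exact lt_of_le_of_lt (lintegral_mono fun s => Real.ofReal_le_enorm _) h.2

/-- **The weak-`L^{q'}` tail bound gives strong integrability at every smaller exponent** (finite
window, layer cake): for a frame solution, `0 < T₂ < T`, `1 ≤ q < q'` and
`s^{q'} |{t ∈ (T₂,T) : ‖u(t)‖₃ > s}| ≤ C` for all `s > 0`, one has `∫_{T₂}^T ‖u(t)‖₃^q dt < ∞`: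
`∫ f^q = q ∫₀^∞ s^{q-1} |{f > s}| ds ≤ q (|window| + C ∫₁^∞ s^{q-1-q'} ds) < ∞`. [folklore] -/
theorem lintegral_lt_top_of_weakJawClause {ν T : ℝ} (hν : 0 < ν)
    {u : ℝ → EuclideanSpace ℝ (Fin 3) → EuclideanSpace ℝ (Fin 3)} {p : ℝ → EuclideanSpace ℝ (Fin 3) → ℝ}
    (hcl : IsClassicalNSSolutionOn (Ico 0 T) ν 0 u p) (hLH : IsLerayHopfOn T ν 0 (u 0) u)
    (hdec : HasRapidSpatialDecay (u 0)) {T₂ q q' : ℝ} (hT₂ : 0 < T₂) (hq1 : 1 ≤ q) (hqq' : q < q')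
    {C : ℝ≥0}
    (hW : ∀ s : ℝ, 0 < s →
      ENNReal.ofReal (s ^ q') * volume {t ∈ Ioo T₂ T | ENNReal.ofReal s < eLpNorm (u t) 3 volume} ≤ C) :
    (∫⁻ t in Ioo T₂ T, eLpNorm (u t) 3 volume ^ q) < ⊤ := by
  have hq0 : 0 < q := by linarith
  set W : Set ℝ := Ioo T₂ T with hWdef
  set μ : Measure ℝ := volume.restrict W with hμ
  haveI : IsFiniteMeasure μ := by
    rw [hμ, hWdef]
    exact isFiniteMeasure_restrict.2 (by rw [Real.volume_Ioo]; exact ENNReal.ofReal_ne_top)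
  -- the real-valued profile `g(t) = ‖u(t)‖₃` (finite at every `t ∈ W ⊆ [0,T)`)
  set g : ℝ → ℝ := fun t => (eLpNorm (u t) 3 volume).toReal with hg
  have hfinite : ∀ t ∈ W, eLpNorm (u t) 3 volume < ⊤ := fun t ht =>
    eLpNorm_three_lt_top_of_frame hν hcl hLH hdec ⟨hT₂.le.trans ht.1.le, ht.2⟩
  have hg_ae : AEMeasurable g μ :=
    ENNReal.measurable_toReal.comp_aemeasurable (aemeasurable_l3_of_frame hcl hT₂.le)
  have hg_nn : 0 ≤ᵐ[μ] g := Eventually.of_forall fun t => ENNReal.toReal_nonneg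
  -- rewrite the jaw integral through `g`
  have hcongr : (∫⁻ t in W, eLpNorm (u t) 3 volume ^ q) = ∫⁻ t in W, ENNReal.ofReal (g t ^ q) := by
    refine setLIntegral_congr_fun measurableSet_Ioo fun t ht => ?_
    rw [hg, ← ENNReal.ofReal_rpow_of_nonneg ENNReal.toReal_nonneg hq0.le,
      ENNReal.ofReal_toReal (hfinite t ht).ne]
  rw [hcongr, lintegral_rpow_eq_lintegral_meas_lt_mul μ hg_nn hg_ae hq0]
  refine ENNReal.mul_lt_top ENNReal.ofReal_lt_top ?_
  -- tail bounds: `μ{g > s} ≤ |W|` and `μ{g > s} ≤ C s^{-q'}`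
  have htail_W : ∀ s : ℝ, μ {a | s < g a} ≤ ENNReal.ofReal (T - T₂) := fun s => by
    calc μ {a | s < g a} ≤ μ univ := measure_mono (subset_univ _)
      _ = ENNReal.ofReal (T - T₂) := by rw [hμ, Measure.restrict_apply_univ, hWdef, Real.volume_Ioo]
  have htail_C : ∀ s : ℝ, 0 < s → μ {a | s < g a} ≤ (C : ℝ≥0∞) * ENNReal.ofReal (s ^ (-q')) := by
    intro s hs
    have hsub : {a | s < g a} ∩ W ⊆ {t ∈ Ioo T₂ T | ENNReal.ofReal s < eLpNorm (u t) 3 volume} := by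
      rintro t ⟨hlt, htW⟩
      refine ⟨htW, ?_⟩
      exact (ENNReal.ofReal_lt_iff_lt_toReal hs.le (hfinite t htW).ne).2 hlt
    have h1 : μ {a | s < g a} ≤ volume {t ∈ Ioo T₂ T | ENNReal.ofReal s < eLpNorm (u t) 3 volume} := by
      rw [hμ, Measure.restrict_apply' measurableSet_Ioo]
      exact measure_mono hsub
    have hsq : 0 < s ^ q' := Real.rpow_pos_of_pos hs q'
    have hne0 : ENNReal.ofReal (s ^ q') ≠ 0 := (ENNReal.ofReal_pos.2 hsq).ne'
    have h2 : volume {t ∈ Ioo T₂ T | ENNReal.ofReal s < eLpNorm (u t) 3 volume} ≤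
        (C : ℝ≥0∞) / ENNReal.ofReal (s ^ q') := by
      rw [ENNReal.le_div_iff_mul_le (Or.inl hne0) (Or.inl ENNReal.ofReal_ne_top), mul_comm]
      exact hW s hs
    refine h1.trans (h2.trans (le_of_eq ?_))
    rw [div_eq_mul_inv, ← ENNReal.ofReal_inv_of_pos hsq, Real.rpow_neg hs.le]
  -- split `(0,∞) = (0,1] ∪ (1,∞)`
  rw [← Ioc_union_Ioi_eq_Ioi zero_le_one]
  refine lt_of_le_of_lt (lintegral_union_le _ _ _) (ENNReal.add_lt_top.2 ⟨?_, ?_⟩)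
  · -- on `(0,1]`: integrand `≤ |W| · 1`
    have hpt : ∀ s ∈ Ioc (0 : ℝ) 1,
        μ {a | s < g a} * ENNReal.ofReal (s ^ (q - 1)) ≤ ENNReal.ofReal (T - T₂) := by
      intro s hs
      have h1 : ENNReal.ofReal (s ^ (q - 1)) ≤ 1 := by
        rw [← ENNReal.ofReal_one]
        exact ENNReal.ofReal_le_ofReal (Real.rpow_le_one hs.1.le hs.2 (by linarith))
      calc μ {a | s < g a} * ENNReal.ofReal (s ^ (q - 1)) ≤ ENNReal.ofReal (T - T₂) * 1 :=
            mul_le_mul' (htail_W s) h1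
        _ = ENNReal.ofReal (T - T₂) := mul_one _
    refine lt_of_le_of_lt (setLIntegral_mono' measurableSet_Ioc fun s hs => hpt s hs) ?_
    rw [setLIntegral_const, Real.volume_Ioc]
    exact ENNReal.mul_lt_top ENNReal.ofReal_lt_top ENNReal.ofReal_lt_top
  · -- on `(1,∞)`: integrand `≤ C s^{q-1-q'}`, integrable since `q - 1 - q' < -1`
    have hpt : ∀ s ∈ Ioi (1 : ℝ),
        μ {a | s < g a} * ENNReal.ofReal (s ^ (q - 1)) ≤
          (C : ℝ≥0∞) * ENNReal.ofReal (s ^ (q - 1 - q')) := by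
      intro s hs
      have hs0 : 0 < s := lt_trans zero_lt_one hs
      calc μ {a | s < g a} * ENNReal.ofReal (s ^ (q - 1))
          ≤ (C : ℝ≥0∞) * ENNReal.ofReal (s ^ (-q')) * ENNReal.ofReal (s ^ (q - 1)) :=
            mul_le_mul' (htail_C s hs0) le_rfl
        _ = (C : ℝ≥0∞) * ENNReal.ofReal (s ^ (q - 1 - q')) := by
            rw [mul_assoc, ← ENNReal.ofReal_mul (Real.rpow_nonneg hs0.le _), ← Real.rpow_add hs0]
            congr 3
            ring
    refine lt_of_le_of_lt (setLIntegral_mono' measurableSet_Ioi fun s hs => hpt s hs) ?_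
    rw [lintegral_const_mul' _ _ ENNReal.coe_ne_top]
    exact ENNReal.mul_lt_top ENNReal.coe_lt_top (lintegral_Ioi_one_ofReal_rpow_lt_top (by linarith))

/-! ## The crux equals its weak form -/

/-- **`L3CascadeJaw` ↔ its weak-`L^q` (Lorentz `L^{q,∞}`) form over the open range.**  The crux holds
iff for every `q ∈ (4,5)` every frame solution has a final window `(T₂,T)` and a constant `C` with
`s^q |{t ∈ (T₂,T) : ‖u(t)‖₃ > s}| ≤ C` for all `s > 0`.  (⇒) Markov; (⇐) the weak bound at
`q' = (q+5)/2 ∈ (q,5)` gives the strong clause at `q` by the layer-cake lemma. [folklore] -/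
theorem l3CascadeJaw_iff_weak :
    L3CascadeJaw ↔
      ∀ q : ℝ, 4 < q → q < 5 → ∀ (ν T : ℝ), 0 < ν → 0 < T →
        ∀ (u : ℝ → EuclideanSpace ℝ (Fin 3) → EuclideanSpace ℝ (Fin 3)) (p : ℝ → EuclideanSpace ℝ (Fin 3) → ℝ),
          IsClassicalNSSolutionOn (Ico 0 T) ν 0 u p → IsLerayHopfOn T ν 0 (u 0) u →
          HasRapidSpatialDecay (u 0) →
          ∃ T₂ ∈ Ioo 0 T, ∃ C : ℝ≥0, ∀ s : ℝ, 0 < s →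
            ENNReal.ofReal (s ^ q) * volume {t ∈ Ioo T₂ T | ENNReal.ofReal s < eLpNorm (u t) 3 volume} ≤ C := by
  constructor
  · intro hJ q hq4 hq5 ν T hν hT u p hcl hLH hdec
    obtain ⟨T₂, hT₂, hfin⟩ := hJ q hq4 hq5 ν T hν hT u p hcl hLH hdec
    obtain ⟨C, hC⟩ := weakJawClause_of_lintegral_lt_top hcl hT₂.1.le (by linarith) hfin
    exact ⟨T₂, hT₂, C, hC⟩
  · intro hW q hq4 hq5 ν T hν hT u p hcl hLH hdec
    obtain ⟨T₂, hT₂, C, hC⟩ := hW ((q + 5) / 2) (by linarith) (by linarith) ν T hν hT u p hcl hLH hdec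
    exact ⟨T₂, hT₂, lintegral_lt_top_of_weakJawClause hν hcl hLH hdec hT₂.1 (by linarith) (by linarith) hC⟩

/-- **A weak-`L^{q'}` final window gives the STRONG clause at every exponent `0 ≤ q < q'`** for a
frame solution (layer cake between `max 1 ((q+q')/2)` and `q'`, then antitonicity; for `q' ≤ 1` the
clause at `q ≤ 4` is the unconditional energy floor) — the clause-shaped corollary of
`lintegral_lt_top_of_weakJawClause`. [folklore] -/
theorem jawClause_of_weakJawClause {ν T : ℝ} (hν : 0 < ν)
    {u : ℝ → EuclideanSpace ℝ (Fin 3) → EuclideanSpace ℝ (Fin 3)} {p : ℝ → EuclideanSpace ℝ (Fin 3) → ℝ}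
    (hcl : IsClassicalNSSolutionOn (Ico 0 T) ν 0 u p) (hLH : IsLerayHopfOn T ν 0 (u 0) u)
    (hdec : HasRapidSpatialDecay (u 0)) {q q' : ℝ} (hq0 : 0 ≤ q) (hqq' : q < q')
    (hW : ∃ T₂ ∈ Ioo 0 T, ∃ C : ℝ≥0, ∀ s : ℝ, 0 < s →
      ENNReal.ofReal (s ^ q') * volume {t ∈ Ioo T₂ T | ENNReal.ofReal s < eLpNorm (u t) 3 volume} ≤ C) :
    ∃ T₂ ∈ Ioo 0 T, (∫⁻ t in Ioo T₂ T, eLpNorm (u t) 3 volume ^ q) < ⊤ := by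
  obtain ⟨T₂, hT₂, C, hC⟩ := hW
  rcases lt_or_ge 1 q' with h1 | h1
  · have hq₁ : 1 ≤ max 1 ((q + q') / 2) := le_max_left _ _
    have hq₁' : max 1 ((q + q') / 2) < q' := max_lt h1 (by linarith)
    have hstrong := lintegral_lt_top_of_weakJawClause hν hcl hLH hdec hT₂.1 hq₁ hq₁' hC
    exact jawClause_anti hq0 ((by linarith : q ≤ (q + q') / 2).trans (le_max_right _ _)) ⟨T₂, hT₂, hstrong⟩
  · -- `q < q' ≤ 1 ≤ 4`: the clause at `q` is unconditional (energy floor)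
    exact jawClause_anti hq0 (by linarith : q ≤ 4)
      (L3TimeExponentPincerJawExponentCalculus.jawClause_of_le_four 4 (by norm_num) le_rfl ν T hν
        (hT₂.1.trans hT₂.2) u p hcl hLH hdec)

end Summit.NavierStokesRegularity.NavierStokesRegularity.Theorems.L3TimeExponentPincerJawWeakStrong

end
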